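import Mathlib
import Literature.Analysis.FluidPDE.SuitableWeak
import Literature.Analysis.FluidPDE.Seregin2023.TypeIIEulerZoom
import Summits.NavierStokesRegularity.NavierStokesRegularity.Theses.EulerZoomLiouville
import Summits.NavierStokesRegularity.NavierStokesRegularity.Theorems.EulerZoomLiouvillePowerGaugeEulerLiouvilleAxisymDSS
import HarnessLib

/-!
# Rung C1 ∩ {axisymmetric} of the crux `EulerZoomLiouville.PowerGaugeEulerLiouville` in PROFILE form
# (route №10, item stmt-NavierStokesRegularity-19832) — every `ρ > 0`

Helper file (theorems only; `--supports stmt-NavierStokesRegularity-19832`). Seat ns-typeII-p3 (cell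
ns-regularity-ideate §B, D-0081). Sequel of `…AxisymDSS.lean` / `…AxisymNoSwirlDSS.lean`: the exactly
self-similar corollaries restated with hypotheses on the PROFILE `V` only, in the shape the printed
self-similar literature uses (Chae–Shvydkoy 2013, Constantin–Ignatova–Vicol 2026, Chae 2007).

For an exactly self-similar member `u(τ, y) = (−τ)^{−m} V((−τ)^{−n} y)` (`n = 1/(2+ρ)`, `m = (1+ρ)/(2+ρ)`,
the velocity part of `Lines/rungC_window.lean :: IsSelfSimilarPair`) every slice is a dilation of `V`, so:
axisymmetry / absence of swirl of the slices follow from those of `V` (`isAxisymmetric_smul_comp_smul`,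
`hasNoSwirl_smul_comp_smul`); `V = u(−1)` is smooth when `u` is classical (`profile_eq_slice`); bounded
`V`, `∇V` give locally-uniformly bounded `u`, `∇u` (`selfSimilar_slice_bounds`); `Θ_V = angVortQuot V ∈ L²`
and `(r V_θ)^k ∈ L²` give the locally uniform slice integrabilities (`selfSimilar_angVortQuot_sq_bounds`,
`selfSimilar_swirl_pow_sq_bounds`: `∫η(τ)² = (−τ)^{−2m}(−τ)^{−n}∫Θ_V²`,
`∫Γ(τ)^{2k} = ((−τ)^{−m}(−τ)^{n})^{2k}(−τ)^{3n}∫Γ_V^{2k}`, monotone in `τ` factor by factor).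

* `powerGaugeEulerLiouville_axisym_selfSimilar_profile` — **no exactly self-similar AXISYMMETRIC Euler
  collapse in the power-gauged class** for classical members whose profile `V` is axisymmetric, bounded with
  bounded gradient, with `ω_θ/r ∈ L²(ℝ³)` and `(r V_θ)^k ∈ L²(ℝ³)` for one `k ≥ 1`, `2kρ ≠ 3`;
* `powerGaugeEulerLiouville_axisymNoSwirl_selfSimilar_profile` — the swirl-free version (no `k`).

WHAT THIS IS NOT: not NS, not the crux E, not rung C1 whole — the non-axisymmetric window and the
weak (non-classical) members are untouched. [folklore]
-/

noncomputable section

-- the summit and its single problem share the name `NavierStokesRegularity` (D-0017 nested layout)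
set_option linter.dupNamespace false

open Set Function Filter Topology MeasureTheory Metric
open scoped NNReal ENNReal InnerProductSpace RealInnerProductSpace

namespace Summit.NavierStokesRegularity.NavierStokesRegularity.Theorems.PowerGaugeEulerLiouville.AxisymNoSwirl

open Literature.Analysis Literature.Analysis.FluidPDE
open Summit.NavierStokesRegularity.NavierStokesRegularity.Theorems.PowerGaugeEulerLiouville

section Profile

variable {ρ : ℝ} {u : ℝ → (EuclideanSpace ℝ (Fin 3)) → (EuclideanSpace ℝ (Fin 3))}
  {V : (EuclideanSpace ℝ (Fin 3)) → (EuclideanSpace ℝ (Fin 3))}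

/-- The slices of an exactly self-similar field are dilations of the profile (function form). [folklore] -/
theorem selfSimilar_slice_eq
    (hss : ∀ τ : ℝ, τ < 0 → ∀ y : (EuclideanSpace ℝ (Fin 3)),
      u τ y = ((-τ) ^ (-((1 + ρ) / (2 + ρ)))) • V (((-τ) ^ (-(1 / (2 + ρ)))) • y))
    {τ : ℝ} (hτ : τ < 0) :
    u τ = fun y => ((-τ) ^ (-((1 + ρ) / (2 + ρ)))) • V (((-τ) ^ (-(1 / (2 + ρ)))) • y) :=
  funext fun y => hss τ hτ y

/-- The profile is the slice at `τ = −1`: `V = u(−1)`. [folklore] -/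
theorem profile_eq_slice
    (hss : ∀ τ : ℝ, τ < 0 → ∀ y : (EuclideanSpace ℝ (Fin 3)),
      u τ y = ((-τ) ^ (-((1 + ρ) / (2 + ρ)))) • V (((-τ) ^ (-(1 / (2 + ρ)))) • y)) :
    V = u (-1) := by
  funext y
  have h := hss (-1) (by norm_num) y
  simp only [neg_neg, Real.one_rpow, one_smul] at h
  exact h.symm

/-- Slices of an exactly self-similar field with axisymmetric profile are axisymmetric. [folklore] -/
theorem selfSimilar_isAxisymmetric_slice
    (hss : ∀ τ : ℝ, τ < 0 → ∀ y : (EuclideanSpace ℝ (Fin 3)),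
      u τ y = ((-τ) ^ (-((1 + ρ) / (2 + ρ)))) • V (((-τ) ^ (-(1 / (2 + ρ)))) • y))
    (hax : IsAxisymmetric V) {τ : ℝ} (hτ : τ < 0) : IsAxisymmetric (u τ) := by
  rw [selfSimilar_slice_eq hss hτ]
  exact isAxisymmetric_smul_comp_smul hax _ _

/-- Slices of an exactly self-similar field with swirl-free profile are swirl free. [folklore] -/
theorem selfSimilar_hasNoSwirl_slice
    (hss : ∀ τ : ℝ, τ < 0 → ∀ y : (EuclideanSpace ℝ (Fin 3)),
      u τ y = ((-τ) ^ (-((1 + ρ) / (2 + ρ)))) • V (((-τ) ^ (-(1 / (2 + ρ)))) • y))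
    (hsw : HasNoSwirl V) {τ : ℝ} (hτ : τ < 0) : HasNoSwirl (u τ) := by
  rw [selfSimilar_slice_eq hss hτ]
  exact hasNoSwirl_smul_comp_smul hsw _ (Real.rpow_pos_of_pos (by linarith) _).ne'

/-- **Locally uniform slice bounds from profile bounds**: if `‖V‖, ‖∇V‖ ≤ B`, then on every
`[s, t] ⊂ (−∞, 0)` the slices satisfy `‖u(τ)‖, ‖∇u(τ)‖ ≤ B (−t)^{−m} (1 + (−t)^{−n})`
(`m, n > 0`: the dilation factors are antitone in `−τ`). [folklore] -/
theorem selfSimilar_slice_bounds (hρ : 0 < ρ)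
    (hss : ∀ τ : ℝ, τ < 0 → ∀ y : (EuclideanSpace ℝ (Fin 3)),
      u τ y = ((-τ) ^ (-((1 + ρ) / (2 + ρ)))) • V (((-τ) ^ (-(1 / (2 + ρ)))) • y))
    (hVd : Differentiable ℝ V) {B : ℝ} (hB : ∀ y, ‖V y‖ ≤ B ∧ ‖fderiv ℝ V y‖ ≤ B) :
    ∀ s t : ℝ, s < t → t < 0 → ∃ B' : ℝ, ∀ τ ∈ Icc s t, ∀ y,
      ‖u τ y‖ ≤ B' ∧ ‖fderiv ℝ (u τ) y‖ ≤ B' := by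
  intro s t hst ht
  have hB0 : 0 ≤ B := (norm_nonneg _).trans (hB 0).1
  have h2ρ : 0 < 2 + ρ := by linarith
  have hm : -((1 + ρ) / (2 + ρ)) ≤ 0 := by
    have : 0 ≤ (1 + ρ) / (2 + ρ) := div_nonneg (by linarith) h2ρ.le
    linarith
  have hn : -(1 / (2 + ρ)) ≤ 0 := by
    have : 0 ≤ 1 / (2 + ρ) := div_nonneg zero_le_one h2ρ.le
    linarith
  set cT : ℝ := (-t) ^ (-((1 + ρ) / (2 + ρ))) with hcT
  set lT : ℝ := (-t) ^ (-(1 / (2 + ρ))) with hlT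
  have hcT0 : 0 ≤ cT := Real.rpow_nonneg (by linarith) _
  have hlT0 : 0 ≤ lT := Real.rpow_nonneg (by linarith) _
  refine ⟨cT * B + cT * lT * B, fun τ hτ y => ?_⟩
  have hτ0 : 0 < -τ := by linarith [hτ.2]
  have htτ : -t ≤ -τ := by linarith [hτ.2]
  set c : ℝ := (-τ) ^ (-((1 + ρ) / (2 + ρ))) with hc
  set lam : ℝ := (-τ) ^ (-(1 / (2 + ρ))) with hlam
  have hc0 : 0 ≤ c := Real.rpow_nonneg hτ0.le _
  have hlam0 : 0 ≤ lam := Real.rpow_nonneg hτ0.le _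
  have hcle : c ≤ cT :=
    (Real.antitoneOn_rpow_Ioi_of_exponent_nonpos hm) (mem_Ioi.2 (by linarith : (0:ℝ) < -t))
      (mem_Ioi.2 hτ0) htτ
  have hlamle : lam ≤ lT :=
    (Real.antitoneOn_rpow_Ioi_of_exponent_nonpos hn) (mem_Ioi.2 (by linarith : (0:ℝ) < -t))
      (mem_Ioi.2 hτ0) htτ
  have hfun : u τ = fun y => c • V (lam • y) := selfSimilar_slice_eq hss (by linarith [hτ.2])
  have h1 : ‖u τ y‖ ≤ cT * B := by
    rw [hfun]
    simp only [norm_smul, Real.norm_of_nonneg hc0]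
    exact mul_le_mul hcle (hB _).1 (norm_nonneg _) hcT0
  have h2 : ‖fderiv ℝ (u τ) y‖ ≤ cT * lT * B := by
    rw [hfun, fderiv_smul_comp_smul c lam (hVd _), norm_smul, Real.norm_of_nonneg (mul_nonneg hc0 hlam0)]
    exact mul_le_mul (mul_le_mul hcle hlamle hlam0 hcT0) (hB _).2 (norm_nonneg _) (mul_nonneg hcT0 hlT0)
  have hx1 : 0 ≤ cT * lT * B := by positivity
  have hx2 : 0 ≤ cT * B := by positivity
  exact ⟨h1.trans (by linarith), h2.trans (by linarith)⟩

/-- **Locally uniform `L²` bounds for `η = ω_θ/r` from the profile**: `∫ η(u(τ))² =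
(−τ)^{−2m}(−τ)^{−n} ∫ Θ_V²` with `Θ_V = angVortQuot V`. [folklore] -/
theorem selfSimilar_angVortQuot_sq_bounds (hρ : 0 < ρ)
    (hss : ∀ τ : ℝ, τ < 0 → ∀ y : (EuclideanSpace ℝ (Fin 3)),
      u τ y = ((-τ) ^ (-((1 + ρ) / (2 + ρ)))) • V (((-τ) ^ (-(1 / (2 + ρ)))) • y))
    (hax : IsAxisymmetric V) (hV3 : ContDiff ℝ 3 V)
    (hint : Integrable (fun y => angVortQuot V y ^ 2)) :
    ∀ s t : ℝ, s < t → t < 0 → ∃ N : ℝ, ∀ τ ∈ Icc s t,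
      Integrable (fun y => angVortQuot (u τ) y ^ 2) ∧ ∫ y, angVortQuot (u τ) y ^ 2 ≤ N := by
  intro s t hst ht
  have h2ρ : 0 < 2 + ρ := by linarith
  have hm : -((1 + ρ) / (2 + ρ)) ≤ 0 := by
    have : 0 ≤ (1 + ρ) / (2 + ρ) := div_nonneg (by linarith) h2ρ.le
    linarith
  have hn : -(1 / (2 + ρ)) ≤ 0 := by
    have : 0 ≤ 1 / (2 + ρ) := div_nonneg zero_le_one h2ρ.le
    linarith
  set cT : ℝ := (-t) ^ (-((1 + ρ) / (2 + ρ))) with hcT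
  set lT : ℝ := (-t) ^ (-(1 / (2 + ρ))) with hlT
  have hI0 : 0 ≤ ∫ y, angVortQuot V y ^ 2 := integral_nonneg fun y => sq_nonneg _
  refine ⟨cT ^ 2 * lT * ∫ y, angVortQuot V y ^ 2, fun τ hτ => ?_⟩
  have hτ0 : 0 < -τ := by linarith [hτ.2]
  have htτ : -t ≤ -τ := by linarith [hτ.2]
  set c : ℝ := (-τ) ^ (-((1 + ρ) / (2 + ρ))) with hc
  set lam : ℝ := (-τ) ^ (-(1 / (2 + ρ))) with hlam
  have hc0 : 0 < c := Real.rpow_pos_of_pos hτ0 _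
  have hlam0 : 0 < lam := Real.rpow_pos_of_pos hτ0 _
  have hcle : c ≤ cT :=
    (Real.antitoneOn_rpow_Ioi_of_exponent_nonpos hm) (mem_Ioi.2 (by linarith : (0:ℝ) < -t))
      (mem_Ioi.2 hτ0) htτ
  have hlamle : lam ≤ lT :=
    (Real.antitoneOn_rpow_Ioi_of_exponent_nonpos hn) (mem_Ioi.2 (by linarith : (0:ℝ) < -t))
      (mem_Ioi.2 hτ0) htτ
  have hfun : u τ = fun y => c • V (lam • y) := selfSimilar_slice_eq hss (by linarith [hτ.2])
  rw [hfun]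
  refine ⟨(integrable_angVortQuot_sq_smul_comp_smul_iff hax hV3 hc0.ne' hlam0.ne').2 hint, ?_⟩
  rw [integral_angVortQuot_sq_smul_comp_smul hax hV3 c hlam0]
  have : c ^ 2 * lam ≤ cT ^ 2 * lT :=
    mul_le_mul (pow_le_pow_left₀ hc0.le hcle 2) hlamle hlam0.le (sq_nonneg _)
  exact mul_le_mul_of_nonneg_right this hI0

/-- **Locally uniform `L²` bounds for `Γ^k = (r u_θ)^k` from the profile**:
`∫ (Γ(u(τ))^k)² = ((−τ)^{−m} ((−τ)^{−n})⁻¹)^{2k} (((−τ)^{−n})³)⁻¹ ∫ (Γ_V^k)²`, each factor monotone in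
`τ`. [folklore] -/
theorem selfSimilar_swirl_pow_sq_bounds (hρ : 0 < ρ)
    (hss : ∀ τ : ℝ, τ < 0 → ∀ y : (EuclideanSpace ℝ (Fin 3)),
      u τ y = ((-τ) ^ (-((1 + ρ) / (2 + ρ)))) • V (((-τ) ^ (-(1 / (2 + ρ)))) • y))
    (k : ℕ) (hint : Integrable (fun y => (swirl V y ^ k) ^ 2)) :
    ∀ s t : ℝ, s < t → t < 0 → ∃ N : ℝ, ∀ τ ∈ Icc s t,
      Integrable (fun y => (swirl (u τ) y ^ k) ^ 2) ∧ ∫ y, (swirl (u τ) y ^ k) ^ 2 ≤ N := by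
  intro s t hst ht
  have h2ρ : 0 < 2 + ρ := by linarith
  have hm : -((1 + ρ) / (2 + ρ)) ≤ 0 := by
    have : 0 ≤ (1 + ρ) / (2 + ρ) := div_nonneg (by linarith) h2ρ.le
    linarith
  have hn0 : 0 ≤ 1 / (2 + ρ) := div_nonneg zero_le_one h2ρ.le
  -- monotone envelopes: `c ≤ cT`, `lam⁻¹ = (−τ)^{n} ≤ (−s)^{n}`
  set cT : ℝ := (-t) ^ (-((1 + ρ) / (2 + ρ))) with hcT
  set mS : ℝ := (-s) ^ (1 / (2 + ρ)) with hmS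
  have hcT0 : 0 ≤ cT := Real.rpow_nonneg (by linarith) _
  have hmS0 : 0 ≤ mS := Real.rpow_nonneg (by linarith) _
  have hI0 : 0 ≤ ∫ y, (swirl V y ^ k) ^ 2 := integral_nonneg fun y => sq_nonneg _
  refine ⟨(cT * mS) ^ (2 * k) * mS ^ 3 * ∫ y, (swirl V y ^ k) ^ 2, fun τ hτ => ?_⟩
  have hτ0 : 0 < -τ := by linarith [hτ.2]
  have htτ : -t ≤ -τ := by linarith [hτ.2]
  have hτs : -τ ≤ -s := by linarith [hτ.1]
  set c : ℝ := (-τ) ^ (-((1 + ρ) / (2 + ρ))) with hc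
  set lam : ℝ := (-τ) ^ (-(1 / (2 + ρ))) with hlam
  have hc0 : 0 < c := Real.rpow_pos_of_pos hτ0 _
  have hlam0 : 0 < lam := Real.rpow_pos_of_pos hτ0 _
  have hcle : c ≤ cT :=
    (Real.antitoneOn_rpow_Ioi_of_exponent_nonpos hm) (mem_Ioi.2 (by linarith : (0:ℝ) < -t))
      (mem_Ioi.2 hτ0) htτ
  have hlaminv : lam⁻¹ = (-τ) ^ (1 / (2 + ρ)) := by
    rw [hlam, Real.rpow_neg hτ0.le, inv_inv]
  have hlaminvle : lam⁻¹ ≤ mS := by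
    rw [hlaminv]; exact Real.rpow_le_rpow hτ0.le hτs hn0
  have hfun : u τ = fun y => c • V (lam • y) := selfSimilar_slice_eq hss (by linarith [hτ.2])
  rw [hfun]
  constructor
  · -- integrability: a constant multiple of a dilation of an integrable function
    have h1 : (fun y : (EuclideanSpace ℝ (Fin 3)) =>
        (swirl (fun z : (EuclideanSpace ℝ (Fin 3)) => c • V (lam • z)) y ^ k) ^ 2) =
        fun y => (c * lam⁻¹) ^ (2 * k) *
          (fun z : (EuclideanSpace ℝ (Fin 3)) => (swirl V z ^ k) ^ 2) (lam • y) := by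
      funext y
      rw [swirl_smul_comp_smul V c hlam0.ne' y]
      ring
    rw [h1]
    exact ((integrable_comp_smul_iff volume (fun z : (EuclideanSpace ℝ (Fin 3)) => (swirl V z ^ k) ^ 2)
      hlam0.ne').2 hint).const_mul _
  · rw [integral_swirl_pow_sq_smul_comp_smul V c hlam0 k]
    have hfac : (c * lam⁻¹) ^ (2 * k) * (lam ^ 3)⁻¹ ≤ (cT * mS) ^ (2 * k) * mS ^ 3 := by
      have h1 : c * lam⁻¹ ≤ cT * mS :=
        mul_le_mul hcle hlaminvle (inv_nonneg.2 hlam0.le) hcT0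
      have h2 : (lam ^ 3)⁻¹ ≤ mS ^ 3 := by
        rw [← inv_pow]; exact pow_le_pow_left₀ (inv_nonneg.2 hlam0.le) hlaminvle 3
      exact mul_le_mul (pow_le_pow_left₀ (by positivity) h1 _) h2 (by positivity) (by positivity)
    exact mul_le_mul_of_nonneg_right hfac hI0

/-- **Rung C1 ∩ {axisymmetric}, profile form: no exactly self-similar AXISYMMETRIC Euler collapse in the
power-gauged class** (every `ρ > 0`): the crux VERBATIM restricted to members that are classical on the
open slab and exactly self-similar, `u(τ,y) = (−τ)^{−(1+ρ)/(2+ρ)} V((−τ)^{−1/(2+ρ)} y)`, with an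
AXISYMMETRIC profile `V` (swirl allowed) that is bounded with bounded gradient and has
`ω_θ/r = angVortQuot V ∈ L²(ℝ³)` and `(r V_θ)^k ∈ L²(ℝ³)` for one `k ≥ 1` with `2kρ ≠ 3`. [folklore] -/
theorem powerGaugeEulerLiouville_axisym_selfSimilar_profile :
    ∀ ρ : ℝ, 0 < ρ → ∀ (u : ℝ → EuclideanSpace ℝ (Fin 3) → EuclideanSpace ℝ (Fin 3))
      (p : ℝ → EuclideanSpace ℝ (Fin 3) → ℝ)
      (H : ℝ → EuclideanSpace ℝ (Fin 3) → EuclideanSpace ℝ (Fin 3) →L[ℝ] EuclideanSpace ℝ (Fin 3)) (c : ℝ≥0)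
      (V : EuclideanSpace ℝ (Fin 3) → EuclideanSpace ℝ (Fin 3)) (B : ℝ) (k : ℕ),
      IsSuitableWeakSolutionOn (slab (EuclideanSpace ℝ (Fin 3)) (Set.Iio 0) isOpen_Iio) 0 0 u p →
      HasWeakSpatialGradientOn (slab (EuclideanSpace ℝ (Fin 3)) (Set.Iio 0) isOpen_Iio) u H →
      (∀ a : ℝ, 0 < a → ENNReal.ofReal (a ^ (2 * ρ)) * cknA a (0 : ℝ × EuclideanSpace ℝ (Fin 3)) u +
        ENNReal.ofReal (a ^ ρ) * cknE a (0 : ℝ × EuclideanSpace ℝ (Fin 3)) H +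
        ENNReal.ofReal (a ^ (2 * ρ)) * cknD a (0 : ℝ × EuclideanSpace ℝ (Fin 3)) p ≤ (c : ℝ≥0∞)) →
      IsClassicalNSSolutionOn (Set.Iio 0) 0 0 u p →
      (∀ τ : ℝ, τ < 0 → ∀ y : EuclideanSpace ℝ (Fin 3),
        u τ y = ((-τ) ^ (-((1 + ρ) / (2 + ρ)))) • V (((-τ) ^ (-(1 / (2 + ρ)))) • y)) →
      IsAxisymmetric V →
      (∀ y, ‖V y‖ ≤ B ∧ ‖fderiv ℝ V y‖ ≤ B) →
      Integrable (fun y => angVortQuot V y ^ 2) →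
      1 ≤ k → 2 * (k : ℝ) * ρ ≠ 3 → Integrable (fun y => (swirl V y ^ k) ^ 2) →
      Function.uncurry u =ᵐ[volume.restrict (Set.Iio (0 : ℝ) ×ˢ (Set.univ : Set (EuclideanSpace ℝ (Fin 3))))] 0 := by
  intro ρ hρ u p H c V B k _ hH hc hns hss hax hB hΘ hk1 hk hΓ
  have hV : V = u (-1) := profile_eq_slice hss
  have hVs := hns.contDiff_velocity (show (-1 : ℝ) ∈ Set.Iio 0 by norm_num)
  rw [← hV] at hVs
  have hV3 : ContDiff ℝ 3 V := hVs.of_le (by norm_cast)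
  exact ae_eq_zero_of_gauge_of_axisym_dss hρ hH hc hns (fun τ hτ => selfSimilar_isAxisymmetric_slice hss hax hτ)
    one_lt_two (dss_of_selfSimilar hρ hss two_pos)
    (selfSimilar_slice_bounds hρ hss (hVs.differentiable (by simp)) hB) hk1 hk
    (selfSimilar_swirl_pow_sq_bounds hρ hss k hΓ)
    (selfSimilar_angVortQuot_sq_bounds hρ hss hax hV3 hΘ)

/-- **Rung C1 ∩ C3, profile form: no exactly self-similar axisymmetric SWIRL-FREE Euler collapse in the
power-gauged class** (every `ρ > 0`): as above with a swirl-free profile, and only `ω_θ/r ∈ L²(ℝ³)`.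
[folklore] -/
theorem powerGaugeEulerLiouville_axisymNoSwirl_selfSimilar_profile :
    ∀ ρ : ℝ, 0 < ρ → ∀ (u : ℝ → EuclideanSpace ℝ (Fin 3) → EuclideanSpace ℝ (Fin 3))
      (p : ℝ → EuclideanSpace ℝ (Fin 3) → ℝ)
      (H : ℝ → EuclideanSpace ℝ (Fin 3) → EuclideanSpace ℝ (Fin 3) →L[ℝ] EuclideanSpace ℝ (Fin 3)) (c : ℝ≥0)
      (V : EuclideanSpace ℝ (Fin 3) → EuclideanSpace ℝ (Fin 3)) (B : ℝ),
      IsSuitableWeakSolutionOn (slab (EuclideanSpace ℝ (Fin 3)) (Set.Iio 0) isOpen_Iio) 0 0 u p →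
      HasWeakSpatialGradientOn (slab (EuclideanSpace ℝ (Fin 3)) (Set.Iio 0) isOpen_Iio) u H →
      (∀ a : ℝ, 0 < a → ENNReal.ofReal (a ^ (2 * ρ)) * cknA a (0 : ℝ × EuclideanSpace ℝ (Fin 3)) u +
        ENNReal.ofReal (a ^ ρ) * cknE a (0 : ℝ × EuclideanSpace ℝ (Fin 3)) H +
        ENNReal.ofReal (a ^ (2 * ρ)) * cknD a (0 : ℝ × EuclideanSpace ℝ (Fin 3)) p ≤ (c : ℝ≥0∞)) →
      IsClassicalNSSolutionOn (Set.Iio 0) 0 0 u p →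
      (∀ τ : ℝ, τ < 0 → ∀ y : EuclideanSpace ℝ (Fin 3),
        u τ y = ((-τ) ^ (-((1 + ρ) / (2 + ρ)))) • V (((-τ) ^ (-(1 / (2 + ρ)))) • y)) →
      IsAxisymmetric V → HasNoSwirl V →
      (∀ y, ‖V y‖ ≤ B ∧ ‖fderiv ℝ V y‖ ≤ B) →
      Integrable (fun y => angVortQuot V y ^ 2) →
      Function.uncurry u =ᵐ[volume.restrict (Set.Iio (0 : ℝ) ×ˢ (Set.univ : Set (EuclideanSpace ℝ (Fin 3))))] 0 := by
  intro ρ hρ u p H c V B _ hH hc hns hss hax hsw hB hΘ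
  have hV : V = u (-1) := profile_eq_slice hss
  have hVs := hns.contDiff_velocity (show (-1 : ℝ) ∈ Set.Iio 0 by norm_num)
  rw [← hV] at hVs
  have hV3 : ContDiff ℝ 3 V := hVs.of_le (by norm_cast)
  exact ae_eq_zero_of_gauge_of_axisymNoSwirl_dss hρ hH hc hns
    (fun τ hτ => selfSimilar_isAxisymmetric_slice hss hax hτ)
    (fun τ hτ => selfSimilar_hasNoSwirl_slice hss hsw hτ)
    one_lt_two (dss_of_selfSimilar hρ hss two_pos)
    (selfSimilar_slice_bounds hρ hss (hVs.differentiable (by simp)) hB)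
    (selfSimilar_angVortQuot_sq_bounds hρ hss hax hV3 hΘ)

end Profile

end Summit.NavierStokesRegularity.NavierStokesRegularity.Theorems.PowerGaugeEulerLiouville.AxisymNoSwirl

end
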